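/-
Copyright: the b2b-balaban cell (near-miss cell 7), T⁴-continuum fan-out, lineage t4-ne7b-p3 (node U5c LARGE-DEVIATION
member P3).  Released under the licence of the surrounding project.
-/
import Summits.QuantumFields.BalabanUV.T4Continuum.Support.SpaceTimeInstance

/-!
# Space-time Peierls ∕ Cramér route for NE7b — NON-VACUITY OF THE OCCUPANCY INSTANCE: the hypotheses of
# `LinData.lineageReadings` are jointly satisfiable with a NONEMPTY bad class and POSITIVE weights

Summits-side support leaf of the T⁴-continuum cell (rung (B)+1 on a FINITE torus only; NOT infinite volume, NOT the
mass gap, NOT the Clay statement; NOT a proof of the spine estimate NE7b).  Lineage `t4-ne7b-p3` (generation 2), node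
U5c, skeleton `t4/skeletons/NE7b-t4-ne7b-p3.md` §11 (sanity witness; numerals never enter the route).  [folklore]
a toy instance over `SpaceTimeInstance`; nothing printed is asserted; no `[cite:]` tag.

WHAT.  `toyData`: dimension `1`, torus side `1·4^0`, cutoff `K = 0`, levels `ℓ = id`, ONE term with ONE lineage
`Gen.born b₀ 0` (`b₀ = (0, 0, 0)`: a birth at step `0` of class `0`) whose piece is the single index point `0`, ratios
`ratio 4 0 = 4`.  **`lineageReadings_witness`**: for ANY printed-shape constants `C`, genealogy cutoff `Kc` and flow
`(R, g)`, the readings (i)–(vii) hold for this data with the bad class = the term, weight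
`A = e^{−(credits − lifeCost)(born b₀ 0)} > 0`, remainder `rest = 1`, envelope `nup = 1`, multiplicity `c₃ = 0`,
connector constant `dC = 0` — so `LineageReadings toyData.model C 0 Kc R g A {τ₀} 0 1 …` is INHABITED through
`LinData.lineageReadings` with a nonempty bad class: the hypothesis list of the instance theorem is consistent and
every hypothesis is dischargeable on concrete data.

HONEST DEPENDENCY (cell, verbatim): continuum YM on T⁴ ⇐ BetaPertH ∧ nine spine estimates (0/9 proved); BetaPertH ⇐
(D1) ∧ (D4) ∧ CAP+tail; G-an2-4 gates asym, D1 and NE2/3/4.  This file changes none of it.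
-/

open Finset

namespace Summit.QuantumFields.BalabanUV.T4Continuum.SpaceTimePeierls

open Literature.MathematicalPhysics.QuantumFieldTheory.Balaban1983to89
open Literature.MathematicalPhysics.QuantumFieldTheory.Balaban1983to89.B13ScaleTransfer
open Literature.MathematicalPhysics.QuantumFieldTheory.Balaban1983to89.B16SProfile
open Literature.MathematicalPhysics.QuantumFieldTheory.Balaban1983to89.TreeLength
open T4PersistenceDictionary T4BankedInduction T4PrintedShapeBanking
open Summit.QuantumFields.BalabanUV.T4Continuum.ZoneTorus
open SpaceTimePeierlsLeaves

noncomputable section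

open Classical

namespace Witness

/-- the toy birth event: step `0`, kind `0` (birth), class `0` [folklore] -/
def b₀ : PEv := (0, 0, 0)

/-- **THE TOY LINEAGE DATA**: `d = 1`, `n = 1`, `L = 4`, `Kx = K = 0`, `ℓ = id`; one term, one lineage `born b₀ 0`
with piece `{0}`, ratios `ratio 4 0`. [folklore] -/
def toyData : LinData 1 1 4 0 0 (fun u => u) Unit Unit PEv where
  hN := by norm_num
  hℓK := fun _ hu => hu
  T := {()}
  fam := fun _ => {()}
  G := fun _ => Gen.born b₀ 0
  q := ratio 4 (fun _ => 0)
  step := PEv.step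
  piece := fun _ => {(0 : Pt 1)}

/-- the toy lineage is `SkelOK` (a singleton is a face-connected piece of tree length `0`) [folklore] -/
theorem skelOK_toy (dC : ℝ) : SkelOK toyData.q toyData.step toyData.piece PEv.fat dC (toyData.G ()) := by
  show SkelOK _ _ _ _ _ (Gen.born b₀ 0)
  refine ⟨rfl, ⟨0, mem_singleton_self _⟩, fun x hx y hy => ?_, ?_⟩
  · have hx' : x = 0 := mem_singleton.1 hx
    have hy' : y = 0 := mem_singleton.1 hy
    subst hx'; subst hy'
    exact Relation.ReflTransGen.refl
  · show treeLen ({(0 : Pt 1)} : Finset (Pt 1)) ≤ ((PEv.fat b₀ : ℕ) : ℝ)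
    rw [treeLen_singleton]
    exact Nat.cast_nonneg _

/-- the toy lineage is consistent, well-formed and reaches past the cutoff `0` [folklore] -/
theorem consistent_toy (C : T4PrintedShapeBanking.Consts) (Kc : ℕ) (R : ℕ → ℕ) :
    Consistent C Kc R (toyData.G ()) ∧ (toyData.G ()).WF (dictW R C.n₁) ∧
      0 + 1 ≤ (toyData.G ()).reach (dictW R C.n₁) := by
  show Consistent C Kc R (Gen.born b₀ 0) ∧ (Gen.born b₀ 0).WF (dictW R C.n₁) ∧
    0 + 1 ≤ (Gen.born b₀ 0).reach (dictW R C.n₁)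
  refine ⟨⟨rfl, rfl, Nat.zero_le _⟩, trivial, ?_⟩
  rw [Gen.reach_born, b₀, dictW_birth]
  omega

end Witness

open Witness

/-- **NON-VACUITY OF `LinData.lineageReadings`.**  For any printed-shape constants, genealogy cutoff and flow, the
toy data carries the lineage readings with the NONEMPTY bad class `{τ₀}` and the POSITIVE weight
`A τ₀ = e^{−(credits − lifeCost)(born b₀ 0)}` (remainder `1`, envelope `1`, `c₃ = 0`, `dC = 0`) — obtained THROUGH the
instance theorem, every one of whose hypotheses (i)–(vii) is discharged on the toy. [folklore] -/
theorem lineageReadings_witness (C : T4PrintedShapeBanking.Consts) (Kc : ℕ) (R : ℕ → ℕ) (g : ℕ → ℝ) :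
    ∃ (A : Unit → ℝ) (Bad : Finset Unit), Bad.Nonempty ∧ (∀ τ ∈ Bad, 0 < A τ) ∧
      LineageReadings toyData.model C 0 Kc R g A Bad 0 1 (3 ^ 1 + 4 ^ (2 * 1) + 1)
        ((((3 ^ 1 + 4 ^ (2 * 1) + 1 : ℕ) : ℝ) + 1) ^ 2) (((1 * 4 ^ (0 - 0)) ^ 1 : ℕ) : ℝ) (8 * 126 ^ 1) (126 ^ 1)
        0 0 := by
  set A : Unit → ℝ := fun _ =>
    Real.exp (-(credits (credit C g) (Gen.born b₀ 0) - lifeCost (dictW R C.n₁) (cost C Kc R) (Gen.born b₀ 0))) with hA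
  refine ⟨A, {()}, ⟨(), mem_singleton_self _⟩, fun τ _ => Real.exp_pos _, ?_⟩
  refine toyData.lineageReadings (σ := fun _ => 0) (m := 0) (rest := fun _ _ => 1) (by norm_num) le_rfl
    (fun u => Nat.le_succ u) (fun u => by omega) rfl (fun u => ?_) (fun i k _ _ => by simp) le_rfl le_rfl rfl
    (fun τ _ => (Real.exp_pos _).le) (subset_refl _) le_rfl (fun τ _ => ?_) ?_ (fun τ _ lam _ => ?_)
    (fun 𝒦 τ _ _ lam _ _ => ?_) (fun _ τ _ => zero_le_one) (fun 𝒦 => ?_)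
  · -- (vii) `q u = 4 = 4^{(u+1) − u}`
    show ratio 4 (fun _ => 0) u = 4 ^ (u + 1 - u)
    simp [ratio, qexp]
  · -- (ii) the old structure: the birth `b₀` at step `0 ≤ jlo = 0` with nonempty piece
    exact ⟨(), mem_singleton_self _, b₀, by show b₀ ∈ (Gen.born b₀ 0).events; simp, le_rfl,
      ⟨0, mem_singleton_self _⟩⟩
  · -- (iii) separation: one lineage per term
    exact ⟨fun τ _ lam₁ _ lam₂ _ hne => absurd (Subsingleton.elim lam₁ lam₂) hne⟩
  · -- (iv) consistency ∕ well-formedness ∕ reach ∕ SkelOK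
    obtain ⟨h1, h2, h3⟩ := consistent_toy C Kc R
    cases lam
    exact ⟨h1, h2, h3, skelOK_toy 0⟩
  · -- (v) factorisation with equality
    cases lam
    show A τ ≤ Real.exp (-(credits (credit C g) (Gen.born b₀ 0) -
      lifeCost (dictW R C.n₁) (cost C Kc R) (Gen.born b₀ 0))) * 1
    rw [mul_one]
  · -- (vi) remainder: one term, `rest = 1`, `c₃ = 0`, `nup = 1`
    rw [Real.exp_zero, one_pow, one_mul]
    calc ∑ τ ∈ toyData.model.T.filter (fun τ => toyData.model.IsContour τ 𝒦), (1 : ℝ)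
        ≤ ∑ τ ∈ toyData.model.T, (1 : ℝ) :=
          sum_le_sum_of_subset_of_nonneg (filter_subset _ _) fun _ _ _ => zero_le_one
      _ = 1 := by
          show ∑ τ ∈ ({()} : Finset Unit), (1 : ℝ) = 1
          simp

end

end Summit.QuantumFields.BalabanUV.T4Continuum.SpaceTimePeierls
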